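import Literature.Analysis.PDE.SemilinearHeatClassical
import HarnessLib

/-!
# Local well-posedness of semilinear heat systems `∂ₜu = Δu + f(x, u, ∂u)` with smooth bounded
# data: smooth solutions up to the initial time

Analysis/PDE file (everything proved; no definitions, no named facts) assembling the theory of
`SemilinearHeatMild.lean` (existence of a mild solution by contraction), `SemilinearHeatBootstrap.lean`
(spatial regularity and time-Lipschitz bounds) and `SemilinearHeatClassical.lean` (the mild
solution is classical and jointly smooth) into the classical statement (Taylor, *PDE III*,
Ch. 15, §1, with the smoothness remarks there; Lunardi 1995, §7.1): for a smooth
nonlinearity `f(x, u, p)` all of whose derivatives are bounded on `E × {‖(u, p)‖ ≤ R}` for every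
`R`, and smooth initial data `u₀` with all derivatives bounded, there are `T > 0` and a solution
`u`, jointly `C^∞` on `[0, T) × E`, with `u(0) = u₀` and `∂ₜu = Δu + f(x, u, ∂u)` on `(0, T)`;
moreover `u` inherits every common translation symmetry of `f` and `u₀` (periodicity).

* `exists_smooth_solution` — the theorem just described.

## References

* M. E. Taylor, *Partial Differential Equations III. Nonlinear Equations*, 2nd ed., Springer
  (2011), Ch. 15, §1 (semilinear parabolic equations). [TaylorPDEIII2011]
* A. Lunardi, *Analytic Semigroups and Optimal Regularity in Parabolic Problems*, Birkhäuser
  (1995), §7.1. [folklore]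
-/

noncomputable section

open MeasureTheory Set Function Filter Metric Real
open _root_.Topology
open scoped ENNReal NNReal ContDiff Laplacian

namespace Literature.Analysis.PDE

namespace SemilinearHeat

open Literature.Analysis.UnboundedOperators Literature.Analysis.UnboundedOperators.HeatHolder
open Literature.Analysis.FluidPDE

-- nested operator types
set_option maxSynthPendingDepth 3

section WellPosed

variable {E : Type} [NormedAddCommGroup E] [InnerProductSpace ℝ E] [FiniteDimensional ℝ E]
  [MeasurableSpace E] [BorelSpace E]
variable {V : Type} [NormedAddCommGroup V] [NormedSpace ℝ V] [FiniteDimensional ℝ V]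

set_option maxHeartbeats 800000 in
/-- **Local well-posedness of `∂ₜu = Δu + f(x, u, ∂u)` for smooth bounded data.** Let `E` be a
finite-dimensional real inner product space, `V` a finite-dimensional real normed space,
`f : E × V × (E →L V) → V` smooth with, for every `n` and `R`, all derivatives of order `≤ n`
bounded on `E × {‖w‖ ≤ R}`, and `u₀ : E → V` smooth with every derivative bounded. Then there is
`T > 0` and `u : ℝ → E → V` with `u(0) = u₀`, `(t, x) ↦ u(t, x)` of class `C^∞` on `[0, T) × E`,
and `∂ₜu(t, x) = Δu(t)(x) + f(x, u(t, x), ∂u(t)(x))` for `0 < t < T`; if `f(· + v, w) = f(·, w)` and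
`u₀(· + v) = u₀` for all `v` in a set `P`, then `u(t, · + v) = u(t, ·)` for all `t` and `v ∈ P`.
Proof: the mild solution of `exists_mild_solution` (contraction in `C([0,T]; C¹_b)`), its
spatial regularity `holder_bootstrap`, the time-Lipschitz bounds and joint continuity of all
`Dᵏu`, and the classical regularity `contDiffOn_uncurry_Ico`, `hasDerivAt_slice`.
[cite: TaylorPDEIII2011, Ch. 15, §1] -/
theorem exists_smooth_solution (f : E × V × (E →L[ℝ] V) → V) (hf : ContDiff ℝ ∞ f)
    (hB : ∀ (n : ℕ) (R : ℝ), ∃ B, 0 ≤ B ∧ ∀ j ≤ n, ∀ (x : E) (w : V × (E →L[ℝ] V)), ‖w‖ ≤ R →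
      ‖iteratedFDeriv ℝ j f (x, w)‖ ≤ B)
    (u₀ : E → V) (hu₀ : ∀ n, ∃ A, IsCkBounded n A u₀)
    (P : Set E) (hfP : ∀ v ∈ P, ∀ (x : E) (w : V × (E →L[ℝ] V)), f (x + v, w) = f (x, w))
    (hu₀P : ∀ v ∈ P, ∀ x, u₀ (x + v) = u₀ x) :
    ∃ T : ℝ, 0 < T ∧ ∃ u : ℝ → E → V, u 0 = u₀ ∧
      ContDiffOn ℝ ∞ (uncurry u) (Ico 0 T ×ˢ (univ : Set E)) ∧
      (∀ v ∈ P, ∀ t x, u t (x + v) = u t x) ∧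
      ∀ t ∈ Ioo 0 T, ∀ x, deriv (fun s => u s x) t = (Δ (u t)) x + f (x, u t x, fderiv ℝ (u t) x) := by
  classical
  haveI : CompleteSpace V := FiniteDimensional.complete ℝ V
  -- ### the constants for the contraction
  obtain ⟨A₁, hA₁⟩ := hu₀ 1
  set R : ℝ := A₁ + 1 with hRdef
  obtain ⟨B₁, hB₁0, hB₁⟩ := hB 1 R
  have hfM : ∀ (x : E) (w : V × (E →L[ℝ] V)), ‖w‖ ≤ R → ‖f (x, w)‖ ≤ B₁ := fun x w hw => by
    have := hB₁ 0 (Nat.zero_le _) x w hw; rwa [norm_iteratedFDeriv_zero] at this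
  have hfL : ∀ (x : E) (w w' : V × (E →L[ℝ] V)), ‖w‖ ≤ R → ‖w'‖ ≤ R →
      ‖f (x, w) - f (x, w')‖ ≤ B₁ * ‖w - w'‖ := by
    intro x w w' hw hw'
    have hd : ∀ z ∈ closedBall (0 : V × (E →L[ℝ] V)) R, DifferentiableAt ℝ (fun z => f (x, z)) z :=
      fun z _ => (hf.differentiable (by simp) (x, z)).comp z
        ((differentiableAt_const x).prodMk differentiableAt_id)
    have hbd : ∀ z ∈ closedBall (0 : V × (E →L[ℝ] V)) R, ‖fderiv ℝ (fun z => f (x, z)) z‖ ≤ B₁ := by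
      intro z hz
      have hz' : ‖z‖ ≤ R := mem_closedBall_zero_iff.1 hz
      have hcomp : fderiv ℝ (fun z => f (x, z)) z =
          (fderiv ℝ f (x, z)).comp (ContinuousLinearMap.inr ℝ E (V × (E →L[ℝ] V))) := by
        have h1 : HasFDerivAt (fun z : V × (E →L[ℝ] V) => ((x, z) : E × V × (E →L[ℝ] V)))
            (ContinuousLinearMap.inr ℝ E (V × (E →L[ℝ] V))) z :=
          (hasFDerivAt_const x z).prodMk (hasFDerivAt_id z) |>.congr_fderiv (by ext <;> simp)
        exact ((hf.differentiable (by simp) (x, z)).hasFDerivAt.comp z h1).fderiv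
      rw [hcomp]
      calc _ ≤ ‖fderiv ℝ f (x, z)‖ * ‖ContinuousLinearMap.inr ℝ E (V × (E →L[ℝ] V))‖ :=
            ContinuousLinearMap.opNorm_comp_le _ _
        _ ≤ B₁ * 1 := by
            refine mul_le_mul ?_ (ContinuousLinearMap.norm_inr_le_one ℝ E _) (norm_nonneg _) hB₁0
            have := hB₁ 1 le_rfl x z hz'; rwa [norm_iteratedFDeriv_one] at this
        _ = B₁ := mul_one _
    exact (convex_closedBall (0 : V × (E →L[ℝ] V)) R).norm_image_sub_le_of_norm_fderiv_le hd hbd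
      (mem_closedBall_zero_iff.2 hw') (mem_closedBall_zero_iff.2 hw)
  -- ### the mild solution
  obtain ⟨T, hT, hT1, u, hu0, huout, hu1, huR, hum, hDum, hmild, huP⟩ :=
    exists_mild_solution f hf.continuous hA₁ (le_refl (A₁ + 1)) hB₁0 hB₁0 hfM hfL P hfP hu₀P
  -- ### spatial regularity
  have hboot := holder_bootstrap hf hB hu₀ hT1 hu1 huR hum hDum hmild
  have hslices : ∀ n, ∃ A, ∀ t ∈ Ioc 0 T, IsCkBounded n A (u t) := fun n => by
    obtain ⟨M, hM⟩ := hboot n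
    exact ⟨M, fun t ht => (hM t ht).isCkBounded.of_succ⟩
  -- the data extended by zero off `(0, T]`
  set gt : ℝ → E → V := fun s => if s ∈ Ioc 0 T then (fun y => f (y, u s y, fderiv ℝ (u s) y)) else 0
    with hgt
  have hgt_in : ∀ {s}, s ∈ Ioc 0 T → gt s = fun y => f (y, u s y, fderiv ℝ (u s) y) := fun hs => by
    simp only [hgt, hs, if_true]
  have hgt_out : ∀ {s}, s ∉ Ioc 0 T → gt s = 0 := fun hs => by simp only [hgt, hs, if_false]
  obtain ⟨hgm, -, -⟩ := data_basic hf.continuous hfM hu1 huR hum hDum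
  have hgtm : StronglyMeasurable (uncurry gt) := by
    have hfun : uncurry gt = {p : ℝ × E | p.1 ∈ Ioc 0 T}.piecewise
        (uncurry fun s y => f (y, u s y, fderiv ℝ (u s) y)) 0 := by
      funext p
      by_cases hp : p.1 ∈ Ioc 0 T
      · rw [Set.piecewise_eq_of_mem _ _ _ (show p ∈ {p : ℝ × E | p.1 ∈ Ioc 0 T} from hp)]
        simp only [uncurry, hgt, hp, if_true]
      · rw [Set.piecewise_eq_of_notMem _ _ _ (show p ∉ {p : ℝ × E | p.1 ∈ Ioc 0 T} from hp)]
        simp only [uncurry, hgt, hp, if_false, Pi.zero_apply]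
    rw [hfun]
    exact hgm.piecewise (measurable_fst measurableSet_Ioc) stronglyMeasurable_const
  have hgtb : ∀ n, ∃ G, ∀ s, IsCkBounded n G (gt s) := fun n => by
    obtain ⟨M, hM⟩ := hboot n
    obtain ⟨G, hG0, hGd⟩ := data_holder_of_slices hf hB huR hM
    refine ⟨G, fun s => ?_⟩
    by_cases hs : s ∈ Ioc 0 T
    · rw [hgt_in hs]; exact (hGd s hs).isCkBounded
    · rw [hgt_out hs]; exact ((isHolderField_zero n (1 / 2)).mono_const hG0).isCkBounded
  -- the mild representation with the extended data
  have hrep : ∀ t ∈ Ioc 0 T, u t = heatExtension u₀ t +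
      fun x => ∫ s in Ioo 0 t, heatExtension (gt s) (t - s) x := by
    intro t ht
    funext x
    rw [Pi.add_apply, hmild t ht x]
    congr 1
    refine setIntegral_congr_fun measurableSet_Ioo fun s hs => ?_
    rw [hgt_in ⟨hs.1, hs.2.le.trans ht.2⟩]
  have hgt_eq : ∀ t ∈ Ioc 0 T, gt t = fun y => f (y, u t y, fderiv ℝ (u t) y) := fun t ht => hgt_in ht
  -- smooth slices
  have hu₀s : ContDiff ℝ ∞ u₀ := contDiff_infty.2 fun n => by
    obtain ⟨A, hA⟩ := hu₀ n; exact hA.contDiff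
  have hsm : ∀ t, ContDiff ℝ ∞ (u t) := fun t => by
    by_cases ht : t ∈ Ioc 0 T
    · exact contDiff_infty.2 fun n => by
        obtain ⟨A, hA⟩ := hslices n; exact (hA t ht).contDiff
    · rw [huout t ht]; exact hu₀s
  -- ### time regularity: joint continuity of all spatial derivatives on `[0, T] × E`
  have hcont : ∀ k, ContinuousOn (fun p : ℝ × E => iteratedFDeriv ℝ k (u p.1) p.2) (Icc 0 T ×ˢ univ) := by
    intro k
    obtain ⟨A, hA⟩ := hu₀ (k + 2)
    obtain ⟨G, hG⟩ := hgtb (k + 2)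
    exact continuousOn_iteratedFDeriv_slice (fun t _ => (hsm t).of_le (mod_cast (le_top : ((k : ℕ) : ℕ∞) ≤ ⊤)))
      fun s t hs hst htT x => norm_iteratedFDeriv_slice_sub_le hT1 hA hgtm hG hu0 hrep hs hst htT x
  -- ### conclusion
  refine ⟨T, hT, u, hu0, ?_, huP, fun t ht x => ?_⟩
  · exact contDiffOn_uncurry_Ico hf hu₀ hgtm hgtb hT hT1 hsm hslices hcont hrep hgt_eq
  · exact (hasDerivAt_slice hf hu₀ hgtm hgtb hT1 hsm hcont hrep hgt_eq ht x).deriv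

end WellPosed

end SemilinearHeat

end Literature.Analysis.PDE
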